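import Summits.NavierStokesRegularity.FluidComputer.GateBudgetSecondClock
import HarnessLib

/-!
# What no tuning can beat, part 46: THE SECOND PULSE MISFIRES ON THE MASTER TUPLE — at the
# second dousing `T₂` of a lattice dud the output pair holds `≤ 1/60`, the carrier `≥ 59/60`,
# the clock is `-1.42ε ± 0.03ε` and the trigger is cold for `2.7878`: the entry data of the
# THIRD cycle, in one tuple

Cell `pub-fluidc`, blueprint seat bp1 (gen 33, sixth item); same namespace and conventions as
parts 1–45 (`GateBudget*.lean`); imports part 45 (`GateBudgetSecondClock`, and through it parts
44, 43, 42, 41, 38, 33, 22, 18, 16, 14, 1). Modes `0 = a` carrier, `1 = b` clock, `2 = c` trigger,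
`3 = d` transfer, `4 = ã` output; `t₋ = √(2 - 24 log K/K¹⁰)`, `t₊ = √(2 + 2/K¹⁰) + 242/K⁹`,
`λ₀ = K⁻¹⁰ + 4e^{-K¹⁰}/K¹⁰`. HONEST FRAMING (verbatim): low prior, high value-of-information
experiment on Tao's machine paradigm; NOT a claim that NS blows up. Nothing is proved about the
Navier–Stokes equations.

THE POINT (SPEC-INPUT-bp1 §AR item (19b⁗), FILE 1). Part 42 (`knob_dud_second_transfer`) read
the second pulse of a lattice dud (`ε = kK¹⁰ρ²`) on part 41's witnesses `r₁, T₂`: phase pinned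
to `kπ ± 0.07`, output pair `d(T₂)² + ã(T₂)² ≤ 1/40`. Part 45 (`knob_dud_second_dousing`) built
the MASTER TUPLE `T, tz, r₁, T₂` of the first two pulses — part 41's twelve facts verbatim, part
43's first-pulse facts (among them the DRAINED transfer mode `d(r₁)² ≤ 1/(7K²) + 6/K⁹`), the
two-sided clocks `1.394ε ≤ b(r₁) ≤ 1.44ε`, `-1.4401ε ≤ b(T₂) ≤ -1.3939ε` and the second cold
window `c < ρ²/K⁹` on `[T₂, T₂ + 2.7878]` — but not the misfire. Facts about `∃`-witnesses of
different theorems never combine, so this part re-runs part 42's argument VERBATIM on the master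
tuple (its proof consumes exactly part 41's twelve facts) and sharpens it with the drained
transfer mode:
* §137 `knob_dud_second_misfire`: everything part 45 exports, AND on the same tuple: the
  SECOND PULSE'S PHASE PINNED `|(C(T₂) - C(r₁))/ρ² - kπ| ≤ 7/100` (any primitive `C` of the
  trigger; part 16's swing and bracket from `r₁`, part 41's `pin_of_bracket`, `second_psi_le`,
  part 22's `teeth_psi`), the transfer `|d(T₂)| ≤ (7/100)|a(r₁)| + |d(r₁)| + 10⁻⁶` (part 14's
  tracking from `r₁`, drift `≤ 968/K⁸`), the drained entry `|d(r₁)| ≤ 0.02363` (`K ≥ 16`: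
  `1/(7K²) + 6/K⁹ ≤ 1/1792 + 10⁻¹⁰ < 0.02363²`), hence the output pair
  `d(T₂)² + ã(T₂)² ≤ (0.07 + 0.02363 + 10⁻⁶)² + ã(r₁)² + … ≤ 0.0049 + 0.0033 + 0.007 ≤ 1/60`
  (part 42 had `1/40` from `|d(r₁)| ≤ √0.007 = 0.0837`), and the carrier
  `a(T₂)² ≥ 59/60 - 10⁻⁵` (energy identity at `T₂`: `b² + c² ≤ 82ε² ≤ 10⁻⁵`).

READING. One tuple now carries, at the second dousing `T₂`, every hypothesis of part 36's
re-arming theorems (`dud_clock_rearms`: `-β ≤ b(T₂) ≤ 0` with `β = 1.4401ε`, `c(T₂) ≤ 2ρ²/K¹⁰`,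
`d² + ã² ≤ θ = 1/60`; `dud_refires` from the clock's next zero) together with the cold window
that bounds the third re-light time from BELOW (`r₂ ≥ T₂ + 2.7878`): the third cycle is the
successor's instantiation, with loop-gain margin `(59/60)·1.0224 - 1 > 0` at `Δ = 1.43` (with
`θ = 1/40` the margin `0.975·1.0224 - 1` would be NEGATIVE — the sharpening is load-bearing).
After two pulses `≥ 98.3 %` of the energy is still in the carrier.
HONEST LIMITS. (i) The pair bound degrades per pulse through `ã`: `ã(r₁)² ≤ 0.007` is all the
energy identity gives (the output only grows), so pulse `n` enters with `ã² ≲ 0.007(n - 1)` and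
the scheme closes for a FIXED number of pulses only (`≈ 5` before `θ` reaches part 36's
margins); the true per-pulse leak is `sin²(π/98) ≈ 10⁻³`, part 22's budget `7/100` costs
`0.0049`; (ii) lattice members only; (iii) no re-arming, no third ignition here; (iv) `M = K¹⁰`,
`K ≥ 16`, `200ε/K²⁰ ≤ ρ² ≤ 2ε/K¹⁰`, `ε² ≤ 1/(6K²⁰)`; (v) nothing about Navier–Stokes.
[cite: Tao2016AveragedNS, §5.5 Theorem 5.3, (5.5), (5.6), (b-eq), (c-eq), (tcable), (energy-con)]
-/

noncomputable section

namespace Summit.NavierStokesRegularity.FluidComputer.GateBudget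

open Real Set Filter Topology
open Literature.Analysis.FluidPDE.Tao2016AveragedNS

variable {K ε ρ : ℝ} {X : ℝ → Fin 5 → ℝ} {C : ℝ → ℝ}

/-! ## §137 The second pulse misfires on the master tuple: pair `≤ 1/60`, carrier `≥ 59/60` -/

/-- **THE SECOND PULSE OF A LATTICE DUD MISFIRES — ON THE MASTER TUPLE.** Same hypotheses as
part 45's §136 (`M = K¹⁰`, `K ≥ 16`, window member, `ε² ≤ 1/(6K²⁰)`, lattice `ε = kK¹⁰ρ²`, any
primitive `C` of the trigger): there are `T, tz, r₁, T₂` with (a) part 41's twelve facts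
verbatim, (b) part 43's first-pulse facts, (c) part 45's clocks `1.394ε ≤ b(r₁) ≤ 1.44ε`,
kept radius on `[r₁, T₂]`, `-1.4401ε ≤ b(T₂) ≤ -1.3939ε`, cold window `[T₂, T₂ + 2.7878]` —
all re-exported — AND (d): `c(T₂) ≤ 2ρ²/K¹⁰`, the phase pin `|(C(T₂) - C(r₁))/ρ² - kπ| ≤ 7/100`,
the transfer `|d(T₂)| ≤ (7/100)|a(r₁)| + |d(r₁)| + 10⁻⁶`, the drained entry
`|d(r₁)| ≤ 2363/10⁵`, the output pair `d(T₂)² + ã(T₂)² ≤ 1/60` and the carrier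
`a(T₂)² ≥ 59/60 - 10⁻⁵` — part 42's proof verbatim on part 45's tuple, with `|d(r₁)| ≤ 0.0837`
replaced by part 43's drained `0.02363`.
[cite: Tao2016AveragedNS, §5.5 Theorem 5.3, (5.5), (5.6), (b-eq), (c-eq), (tcable), (energy-con)]
-/
theorem knob_dud_second_misfire
    (hX : ∀ t, HasDerivAt X (RotorKnob.rotorCircuit K (K ^ 10) ε ρ (X t)) t)
    (h0 : X 0 = delayInit) (hC : ∀ t, HasDerivAt C (X t 2) t) (hK : 16 ≤ K) (hε : 0 < ε)
    (hεK : ε ^ 2 ≤ 1 / (6 * K ^ 20)) (hρ : 0 < ρ) (hlo : 200 * ε / K ^ 20 ≤ ρ ^ 2)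
    (hhi : K ^ 10 * ρ ^ 2 ≤ 2 * ε) (k : ℕ) (hk : ε = k * K ^ 10 * ρ ^ 2) :
    ∃ T tz r₁ T₂ : ℝ, (√(2 - 24 * Real.log K / K ^ 10) + 28282 / 10000 < r₁ ∧
      r₁ < √(2 + 2 / K ^ 10) + 242 / K ^ 9 + 28542 / 10000 ∧ r₁ < T₂ ∧
      T₂ - r₁ ≤ 242 / K ^ 9 ∧
      (∀ t ∈ Icc r₁ T₂, 0 < X t 2) ∧
      (∀ t ∈ Icc r₁ T₂, (7 / 10 * ε) ^ 2 ≤ X t 1 ^ 2 + X t 2 ^ 2) ∧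
      139 / 100 * ε ≤ X r₁ 1 ∧ X r₁ 2 = ρ ^ 2 / K ^ 9 ∧ X T₂ 1 ≤ -(ε / 4) ∧
      X T₂ 2 ≤ (1 / K ^ 10 + 4 * exp (-K ^ 10) / K ^ 10) * ρ ^ 2 ∧
      993 / 1000 ≤ X r₁ 0 ^ 2 ∧ X T₂ 4 ≤ X r₁ 4 + K * (T₂ - r₁)) ∧
      (√(2 - 24 * Real.log K / K ^ 10) ≤ T ∧ T ≤ √(2 + 2 / K ^ 10) + 242 / K ^ 9 ∧
      -(1414214 / 1000000 * ε) ≤ X T 1 ∧ X T 1 ≤ -(1414213 / 1000000 * ε) ∧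
      T + 1414213 / 1000000 ≤ tz ∧ tz ≤ T + 14242 / 10000 ∧ X tz 1 = 0 ∧
      (∀ r ∈ Icc tz r₁, X r 2 ≤ ρ ^ 2 / K ^ 9 ∧ 993 / 1000 * ε * (r - tz) ≤ X r 1 ∧
        993 / 1000 ≤ X r 0 ^ 2) ∧
      T + 28282 / 10000 < r₁ ∧ r₁ < T + 28542 / 10000 ∧
      X r₁ 3 ^ 2 ≤ 1 / (7 * K ^ 2) + 6 / K ^ 9) ∧
      1394 / 1000 * ε ≤ X r₁ 1 ∧ X r₁ 1 ≤ 144 / 100 * ε ∧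
      (∀ t ∈ Icc r₁ T₂, |X t 1 ^ 2 + X t 2 ^ 2 - (X r₁ 1 ^ 2 + X r₁ 2 ^ 2)| ≤ ε ^ 2 / 10 ^ 6) ∧
      -(14401 / 10000 * ε) ≤ X T₂ 1 ∧ X T₂ 1 ≤ -(13939 / 10000 * ε) ∧
      (∀ t ∈ Icc T₂ (T₂ + 27878 / 10000), X t 2 < ρ ^ 2 / K ^ 9) ∧
      X T₂ 2 ≤ 2 * ρ ^ 2 / K ^ 10 ∧ |(C T₂ - C r₁) / ρ ^ 2 - k * π| ≤ 7 / 100 ∧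
      |X T₂ 3| ≤ 7 / 100 * |X r₁ 0| + |X r₁ 3| + 1 / 10 ^ 6 ∧ |X r₁ 3| ≤ 2363 / 100000 ∧
      X T₂ 3 ^ 2 + X T₂ 4 ^ 2 ≤ 1 / 60 ∧ 59 / 60 - 1 / 10 ^ 5 ≤ X T₂ 0 ^ 2 := by
  have hK0 : 0 < K := by linarith
  have hK9 : 0 < K ^ 9 := by positivity
  have hK10 : 0 < K ^ 10 := by positivity
  have hρ2 : 0 < ρ ^ 2 := by positivity
  have hε2 : 0 < ε ^ 2 := by positivity
  have h8 : (4294967296 : ℝ) ≤ K ^ 8 := by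
    have := headline_pow_floor hK 8; norm_num at this; exact this
  have h10 : (1099511627776 : ℝ) ≤ K ^ 10 := by
    have := headline_pow_floor hK 10; norm_num at this; exact this
  obtain ⟨hq1, -, -, -, -, hρK, hρε, hε1, -, -, hσ, -⟩ := refire_window_facts hK hε hεK hhi
  obtain ⟨-, -, hlam2, -⟩ := cold_facts hK hε
  have hXf := hX
  rw [RotorKnob.rotorCircuit_eq_fiveGate] at hXf
  -- part 45's master tuple: groups (a) part 41, (b) part 43, (c) part 45
  obtain ⟨T, tz, r₁, T₂, ⟨hr1, hr2, hsT, hτ, hc, hr, hb139, hcr₁, hbT, hcT, ha1, hgrow⟩,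
      ⟨hT1, hT2, hbTl, hbTu, htz1, htz2, hbtz, hpost, hTr1, hTr2, hdr₁⟩, hb1394, hb144, hkept,
      hbT₂l, hbT₂u, hcold⟩ := knob_dud_second_dousing hX h0 hC hK hε hεK hρ hlo hhi k hk
  have hr₁0 : 0 ≤ r₁ := by linarith [Real.sqrt_nonneg (2 - 24 * Real.log K / K ^ 10)]
  have hτ0 : 0 ≤ T₂ - r₁ := by linarith
  have hcr0 : 0 < X r₁ 2 := hc r₁ ⟨le_rfl, hsT.le⟩
  have hcT0 : 0 < X T₂ 2 := hc T₂ ⟨hsT.le, le_rfl⟩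
  have hcT2 : X T₂ 2 ≤ 2 * ρ ^ 2 / K ^ 10 := by
    rw [show 2 * ρ ^ 2 / K ^ 10 = 2 * (1 / K ^ 10) * ρ ^ 2 by ring]
    exact hcT.trans (mul_le_mul_of_nonneg_right hlam2 hρ2.le)
  -- the swing from `r₁` (`b₁ = ε/2`, `γ₁ = ρ²/K⁹`, `β = ε/4`, `λ₀ = K⁻¹⁰ + 4e^{-K¹⁰}/K¹⁰`)
  have hη := knob_swing_lower (X := X) (ρ := ρ) (b₁ := ε / 2) (γ₁ := ρ ^ 2 / K ^ 9)
    (by positivity) (by linarith) hcr0 hcr₁.le (by positivity : (0:ℝ) < ε / 4) hbT hcT0 hcT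
  -- part 16's bracket from `r₁` with `ϱ = 7ε/10`, read as a pin by §125
  have hq : ε ^ 2 < K ^ 10 * (7 / 10 * ε) ^ 2 := by
    have hKε : 1099511627776 * ε ^ 2 ≤ K ^ 10 * ε ^ 2 := mul_le_mul_of_nonneg_right h10 hε2.le
    rw [show K ^ 10 * (7 / 10 * ε) ^ 2 = 49 / 100 * (K ^ 10 * ε ^ 2) by ring]
    linarith only [hKε, hε2]
  obtain ⟨hlo', hhi'⟩ := knob_phase_bracket hX h0 hε hρ hK10 hC hsT.le
    (by positivity : (0:ℝ) < 7 / 10 * ε) hq hc hr hη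
  have hw : ε / (K ^ 10 * ρ ^ 2) = k := by
    rw [div_eq_iff (by positivity), hk]; ring
  rw [hw] at hlo' hhi'
  have hηpos : 0 ≤ arctan (ρ ^ 2 / K ^ 9 / (ε / 2))
      + arctan ((1 / K ^ 10 + 4 * exp (-K ^ 10) / K ^ 10) * ρ ^ 2 / (ε / 4)) :=
    add_nonneg (Real.arctan_nonneg.2 (by positivity)) (Real.arctan_nonneg.2 (by positivity))
  have hq0 : 0 ≤ ε ^ 2 / (K ^ 10 * (7 / 10 * ε) ^ 2) := by positivity
  have hq1' : ε ^ 2 / (K ^ 10 * (7 / 10 * ε) ^ 2) < 1 := (div_lt_one (by positivity)).2 hq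
  have hpin := pin_of_bracket (Nat.cast_nonneg k) hηpos (by positivity) hq0 hq1' hlo' hhi'
  have h9 : (68719476736 : ℝ) ≤ K ^ 9 := by
    have := headline_pow_floor hK 9; norm_num at this; exact this
  have h242 : (242 : ℝ) / K ^ 9 ≤ 242 / 68719476736 :=
    div_le_div_of_nonneg_left (by norm_num) (by norm_num) h9
  have hψ := (second_psi_le k hk hε hρ hK hτ).trans
    (teeth_psi hK hε hlo (by positivity : (0:ℝ) ≤ 242 / K ^ 9) (by linarith))
  have hpin7 : |(C T₂ - C r₁) / ρ ^ 2 - k * π| ≤ 7 / 100 := hpin.trans hψ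
  -- part 14's tracking of the transfer mode from `r₁`; drift `≤ 968/K⁸ ≤ 10⁻⁶`
  have htd := knob_phase_tracking_d hX h0 hC hε.le hK0.le hr₁0 hsT.le
  set Φ := (C T₂ - C r₁) / ρ ^ 2 with hΦ
  have heT0 : 0 ≤ X T₂ 4 := e_nonneg hXf h0 hK0.le (by linarith)
  have heT1 : X T₂ 4 ≤ 1 := (le_abs_self _).trans (traj_abs_le_one hXf h0 T₂ 4)
  have hL : ε + ρ ^ 2 * exp (-K ^ 10) + K * X T₂ 4 ≤ 2 * K := by
    have h1 : K * X T₂ 4 ≤ K * 1 := mul_le_mul_of_nonneg_left heT1 hK0.le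
    have h2 : ρ ^ 2 * exp (-K ^ 10) ≤ 1 := by
      have : ε * (1 / K ^ 10) ≤ 1 * 1 :=
        mul_le_mul hε1 (by linarith only [hq1]) (by positivity) zero_le_one
      linarith only [hσ, this]
    linarith only [h1, h2, hε1, hK]
  have hdrift : 2 * ((ε + ρ ^ 2 * exp (-K ^ 10) + K * X T₂ 4) * (T₂ - r₁)) ≤ 1 / 10 ^ 6 := by
    have h1 : (ε + ρ ^ 2 * exp (-K ^ 10) + K * X T₂ 4) * (T₂ - r₁) ≤ 2 * K * (242 / K ^ 9) :=
      mul_le_mul hL hτ hτ0 (by positivity)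
    have h2 : 2 * K * (242 / K ^ 9) = 484 / K ^ 8 := by
      field_simp
      norm_num
    have h3 : (484 : ℝ) / K ^ 8 ≤ 484 / 4294967296 :=
      div_le_div_of_nonneg_left (by norm_num) (by norm_num) h8
    linarith only [h1, h2, h3, htd]
  -- `|sin Φ| ≤ |Φ - kπ| ≤ 7/100`, `|cos Φ| ≤ 1`, `|a(r₁)| ≤ 1`
  have hsin : |sin Φ| ≤ 7 / 100 := by
    have hΘ : Φ = (Φ - k * π) + k * π := by ring
    rw [hΘ, sin_add_nat_mul_pi, abs_mul, abs_pow, abs_neg, abs_one, one_pow, one_mul]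
    exact abs_sin_le_abs.trans hpin7
  have hd2 : |X T₂ 3| ≤ 7 / 100 * |X r₁ 0| + |X r₁ 3| + 1 / 10 ^ 6 := by
    have h1 := abs_sub_abs_le_abs_sub (X T₂ 3) (sin Φ * X r₁ 0 + cos Φ * X r₁ 3)
    have h2 := abs_add_le (sin Φ * X r₁ 0) (cos Φ * X r₁ 3)
    rw [abs_mul, abs_mul] at h2
    have h3 : |sin Φ| * |X r₁ 0| ≤ 7 / 100 * |X r₁ 0| :=
      mul_le_mul_of_nonneg_right hsin (abs_nonneg _)
    have h4 : |cos Φ| * |X r₁ 3| ≤ |X r₁ 3| :=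
      mul_le_of_le_one_left (abs_nonneg _) (abs_cos_le_one _)
    linarith only [h1, h2, h3, h4, htd, hdrift]
  -- the energy identity at `r₁` and at `T₂`
  have hE1 : X r₁ 0 ^ 2 + X r₁ 1 ^ 2 + X r₁ 2 ^ 2 + X r₁ 3 ^ 2 + X r₁ 4 ^ 2 = 1 := by
    simpa [energy, Fin.sum_univ_five] using energy_init hXf h0 r₁
  have hE2 : X T₂ 0 ^ 2 + X T₂ 1 ^ 2 + X T₂ 2 ^ 2 + X T₂ 3 ^ 2 + X T₂ 4 ^ 2 = 1 := by
    simpa [energy, Fin.sum_univ_five] using energy_init hXf h0 T₂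
  have ha10 : |X r₁ 0| ≤ 1 := traj_abs_le_one hXf h0 r₁ 0
  have he10 : 0 ≤ X r₁ 4 := e_nonneg hXf h0 hK0.le hr₁0
  have hxy : |X r₁ 3| ^ 2 + X r₁ 4 ^ 2 ≤ 7 / 1000 := by
    rw [sq_abs]; linarith only [hE1, ha1, sq_nonneg (X r₁ 1), sq_nonneg (X r₁ 2)]
  -- part 43's drained transfer mode: `d(r₁)² ≤ 1/(7K²) + 6/K⁹ ≤ 1/1792 + 10⁻¹⁰`
  have hx : |X r₁ 3| ≤ 2363 / 100000 := by
    have h1 : 1 / (7 * K ^ 2) ≤ (1 : ℝ) / 1792 := by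
      have hK2 : (256 : ℝ) ≤ K ^ 2 := by nlinarith only [hK]
      exact div_le_div_of_nonneg_left (by norm_num) (by norm_num) (by linarith only [hK2])
    have h2 : (6 : ℝ) / K ^ 9 ≤ 6 / 68719476736 :=
      div_le_div_of_nonneg_left (by norm_num) (by norm_num) h9
    exact abs_le_of_sq_le_sq (by linarith only [hdr₁, h1, h2]) (by norm_num)
  have hy : X r₁ 4 ≤ 837 / 10000 := (le_abs_self _).trans
    (abs_le_of_sq_le_sq (by linarith only [hxy, sq_nonneg (|X r₁ 3|)]) (by norm_num))
  have hd2' : |X T₂ 3| ≤ 7 / 100 + |X r₁ 3| + 1 / 10 ^ 6 := by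
    have : 7 / 100 * |X r₁ 0| ≤ 7 / 100 := mul_le_of_le_one_right (by norm_num) ha10
    linarith only [hd2, this]
  have hdsq : X T₂ 3 ^ 2 ≤ (7 / 100 + |X r₁ 3| + 1 / 10 ^ 6) ^ 2 := by
    have h := pow_le_pow_left₀ (abs_nonneg _) hd2' 2; rwa [sq_abs] at h
  have heT : X T₂ 4 ≤ X r₁ 4 + 1 / 10 ^ 7 := by
    have h1 : K * (T₂ - r₁) ≤ K * (242 / K ^ 9) := mul_le_mul_of_nonneg_left hτ hK0.le
    have h2 : K * (242 / K ^ 9) = 242 / K ^ 8 := by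
      field_simp
    have h3 : (242 : ℝ) / K ^ 8 ≤ 242 / 4294967296 :=
      div_le_div_of_nonneg_left (by norm_num) (by norm_num) h8
    linarith only [hgrow, h1, h2, h3]
  have hesq : X T₂ 4 ^ 2 ≤ (X r₁ 4 + 1 / 10 ^ 7) ^ 2 := pow_le_pow_left₀ heT0 heT 2
  have hpair : X T₂ 3 ^ 2 + X T₂ 4 ^ 2 ≤ 1 / 60 := by
    have h14 : 14 / 100 * |X r₁ 3| ≤ 14 / 100 * (2363 / 100000) :=
      mul_le_mul_of_nonneg_left hx (by norm_num)
    have h5 : 2 / 10 ^ 7 * X r₁ 4 ≤ 2 / 10 ^ 7 * (837 / 10000) :=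
      mul_le_mul_of_nonneg_left hy (by norm_num)
    linarith only [hxy, h14, h5, abs_nonneg (X r₁ 3), he10, hdsq, hesq]
  -- `b(T₂)² + c(T₂)² ≤ 10⁻⁵`: `|b(T₂)| ≤ (ε + σ)T₂ ≤ 1.01ε·4.5`, `c(T₂) ≤ 2ρ²/K¹⁰ ≤ ε`
  have hbT2 : X T₂ 1 ^ 2 + X T₂ 2 ^ 2 ≤ 1 / 10 ^ 5 := by
    have hb := abs_b_le hXf h0 hε.le (by positivity) (t := T₂) (by linarith)
    have hσ1 : ρ ^ 2 * exp (-K ^ 10) ≤ ε := by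
      have : ε * (1 / K ^ 10) ≤ ε * 1 :=
        mul_le_mul_of_nonneg_left (by linarith only [hq1]) hε.le
      linarith only [hσ, this]
    have hT45 : T₂ ≤ 45 / 10 := by
      have hsq : √(2 + 2 / K ^ 10) ≤ 3 / 2 := by
        have h2 : 2 / K ^ 10 ≤ 2 / 1099511627776 :=
          div_le_div_of_nonneg_left (by norm_num) (by norm_num) h10
        exact (Real.sqrt_le_left (by norm_num)).2 (by linarith only [h2])
      linarith only [hr2, hτ, hsq, h242]
    have hb9 : |X T₂ 1| ≤ 9 * ε := by
      have : (ε + ρ ^ 2 * exp (-K ^ 10)) * T₂ ≤ (2 * ε) * (45 / 10) :=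
        mul_le_mul (by linarith only [hσ1]) hT45 (by linarith only [hsT, hr₁0])
          (by positivity)
      linarith only [hb, this]
    have hb81 : X T₂ 1 ^ 2 ≤ (9 * ε) ^ 2 := by
      have h := pow_le_pow_left₀ (abs_nonneg _) hb9 2; rwa [sq_abs] at h
    have hc2 : X T₂ 2 ≤ ε := by
      have h1 : 2 * (1 / K ^ 10) * ρ ^ 2 ≤ 2 * (1 / 1099511627776) * ρ ^ 2 :=
        mul_le_mul_of_nonneg_right (mul_le_mul_of_nonneg_left hq1 (by norm_num)) hρ2.le
      linarith only [h1, hcT.trans (mul_le_mul_of_nonneg_right hlam2 hρ2.le), hρε, hρ2]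
    have hc2' : X T₂ 2 ^ 2 ≤ ε ^ 2 := pow_le_pow_left₀ hcT0.le hc2 2
    have hK20 : ε ^ 2 ≤ 1 / (6 * (1099511627776 * 1099511627776)) := by
      have : (1099511627776 : ℝ) * 1099511627776 ≤ K ^ 20 := by
        rw [show K ^ 20 = K ^ 10 * K ^ 10 by ring]
        exact mul_le_mul h10 h10 (by norm_num) hK10.le
      exact hεK.trans
        (div_le_div_of_nonneg_left (by norm_num) (by positivity) (by linarith only [this]))
    linarith only [hb81, hc2', hK20]
  exact ⟨T, tz, r₁, T₂, ⟨hr1, hr2, hsT, hτ, hc, hr, hb139, hcr₁, hbT, hcT, ha1, hgrow⟩,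
    ⟨hT1, hT2, hbTl, hbTu, htz1, htz2, hbtz, hpost, hTr1, hTr2, hdr₁⟩, hb1394, hb144, hkept, hbT₂l,
    hbT₂u, hcold, hcT2, hpin7, hd2, hx, hpair, by linarith only [hE2, hpair, hbT2]⟩

end Summit.NavierStokesRegularity.FluidComputer.GateBudget
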